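import Summits.CriticalPhenomena.PercolationContinuityZ3.Theses.PercTorusSliceFilling

/-!
# Route `PercTorusSliceFilling`, crux `NoCriticalTorusGiant` — stub S1b (`stub_nonSfGiantMarkov`)

First moment over vertices for large non-slice-filling clusters of the discrete torus
`T_n = (ℤ/nℤ)³` (`torusGraph 3 n`), at every edge density `p`: for `n ≥ 1` and `k ≥ 1`,

  `P_{T_n,p}(∃ x, k ≤ |C(x)| ∧ ¬sf_x) ≤ k⁻¹ · Σ_x P_{T_n,p}(k ≤ |C(x)| ∧ ¬sf_x)`,

where `sf_x ≡ ∃ i, ∀ t, ∃ y ∈ C(x), y i = t` ("`C(x)` is slice-filling").  Pointwise, on the event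
there is `x₀` with `k ≤ |C(x₀)|` and `¬sf_{x₀}`; every `y ∈ C(x₀)` has `C(y) = C(x₀)`, so at least
`|C(x₀)| ≥ k` of the events `{k ≤ |C(y)| ∧ ¬sf_y}` occur.  Hence
`k · 1_{event} ≤ Σ_x 1{k ≤ |C(x)| ∧ ¬sf_x}`; integrate over the finite configuration space and
divide by `k`.
-/

namespace Summit.CriticalPhenomena.PercolationContinuityZ3.Theorems.PercTorusSliceFillingNoCriticalTorusGiant

open MeasureTheory ProbabilityTheory
open Literature.Probability.Percolation Literature.Probability.LatticeModels

namespace S1b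

/-- **First-moment Markov over a finite index.** On a finite measure space, if on the event `E`
at least `k` of the finitely many events `A x` occur simultaneously, then
`k · P(E) ≤ Σ_x P(A x)` (integrate the pointwise bound `k · 1_E ≤ Σ_x 1_{A x}`). [folklore] -/
theorem natCast_mul_measureReal_le_sum {Ω V : Type*} [MeasurableSpace Ω] [Fintype V]
    (P : Measure Ω) [IsFiniteMeasure P] (A : V → Set Ω) (E : Set Ω) (k : ℕ)
    (hAm : ∀ x, MeasurableSet (A x)) (hEm : MeasurableSet E)
    (hcount : ∀ ω ∈ E, ∃ F : Finset V, k ≤ F.card ∧ ∀ x ∈ F, ω ∈ A x) :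
    (k : ℝ) * P.real E ≤ ∑ x, P.real (A x) := by
  classical
  have h1 : ∀ x, P.real (A x) = ∫ ω, (A x).indicator (1 : Ω → ℝ) ω ∂P := fun x =>
    (integral_indicator_one (hAm x)).symm
  simp_rw [h1]
  have hint : ∀ x ∈ (Finset.univ : Finset V),
      Integrable (fun ω => (A x).indicator (1 : Ω → ℝ) ω) P :=
    fun x _ => (integrable_const (1 : ℝ)).indicator (hAm x)
  rw [← integral_finsetSum _ hint]
  have hintE : Integrable (fun ω => E.indicator (1 : Ω → ℝ) ω) P :=
    (integrable_const (1 : ℝ)).indicator hEm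
  have hE : (k : ℝ) * P.real E = ∫ ω, (k : ℝ) * E.indicator (1 : Ω → ℝ) ω ∂P := by
    rw [integral_const_mul, integral_indicator_one hEm]
  rw [hE]
  refine integral_mono (hintE.const_mul _) (integrable_finsetSum _ hint) fun ω => ?_
  have hsum : (∑ x, (A x).indicator (1 : Ω → ℝ) ω) =
      ((Finset.univ.filter (fun x => ω ∈ A x)).card : ℝ) := by
    rw [Finset.natCast_card_filter]
    refine Finset.sum_congr rfl fun x _ => ?_
    by_cases hx : ω ∈ A x <;> simp [hx]
  show (k : ℝ) * E.indicator (1 : Ω → ℝ) ω ≤ ∑ x, (A x).indicator (1 : Ω → ℝ) ω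
  rw [hsum]
  by_cases hω : ω ∈ E
  · obtain ⟨F, hkF, hF⟩ := hcount ω hω
    have hFsub : F ⊆ Finset.univ.filter (fun x => ω ∈ A x) :=
      fun x hx => Finset.mem_filter.2 ⟨Finset.mem_univ _, hF x hx⟩
    have hle : k ≤ (Finset.univ.filter (fun x => ω ∈ A x)).card :=
      hkF.trans (Finset.card_le_card hFsub)
    simp only [Set.indicator_of_mem hω, Pi.one_apply, mul_one]
    exact_mod_cast hle
  · simp only [Set.indicator_of_notMem hω, mul_zero]
    exact Nat.cast_nonneg _

end S1b

/-- **Stub S1b — first moment over vertices.**  For `n ≥ 1` and `k ≥ 1`,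
`P_{T_n,p}(∃ x, k ≤ |C(x)| ∧ ¬sf_x) ≤ k⁻¹ · Σ_x P_{T_n,p}(k ≤ |C(x)| ∧ ¬sf_x)`: on the event, the at
least `k` members `y` of the large non-slice-filling cluster `C(x₀)` all have `C(y) = C(x₀)`
(reachability is an equivalence), so `k · 1_{event} ≤ Σ_x 1{k ≤ |C(x)| ∧ ¬sf_x}` pointwise; integrate
over the finite configuration space (`S1b.natCast_mul_measureReal_le_sum`) and divide by `k`.
[folklore] -/
theorem stub_nonSfGiantMarkov :
    ∀ (p : unitInterval) (n k : ℕ) [NeZero n], 1 ≤ k →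
      (bondPercolation (torusGraph 3 n) p).real
          {ω | ∃ x : TorusSite 3 n, k ≤ (openCluster ω x).ncard ∧
            ¬ ∃ i : Fin 3, ∀ t : ZMod n, ∃ y ∈ openCluster ω x, y i = t} ≤
        (k : ℝ)⁻¹ * ∑ x : TorusSite 3 n, (bondPercolation (torusGraph 3 n) p).real
          {ω | k ≤ (openCluster ω x).ncard ∧
            ¬ ∃ i : Fin 3, ∀ t : ZMod n, ∃ y ∈ openCluster ω x, y i = t} := by
  intro p n k _ hk
  have hk0 : (0 : ℝ) < k := by exact_mod_cast hk
  rw [le_inv_mul_iff₀ hk0]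
  refine S1b.natCast_mul_measureReal_le_sum (bondPercolation (torusGraph 3 n) p)
    (fun x => {ω | k ≤ (openCluster ω x).ncard ∧
      ¬ ∃ i : Fin 3, ∀ t : ZMod n, ∃ y ∈ openCluster ω x, y i = t}) _ k
    (fun _ => MeasurableSet.of_discrete) MeasurableSet.of_discrete ?_
  rintro ω ⟨x₀, hk₀, hns⟩
  refine ⟨(openCluster ω x₀).toFinite.toFinset, ?_, fun y hy => ?_⟩
  · rw [← Set.ncard_eq_toFinset_card _ (openCluster ω x₀).toFinite]
    exact hk₀
  · have hy' : y ∈ openCluster ω x₀ := (Set.Finite.mem_toFinset _).1 hy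
    have hC : openCluster ω y = openCluster ω x₀ := by
      ext z
      simp only [openCluster, Set.mem_setOf_eq] at hy' ⊢
      exact ⟨fun h => hy'.trans h, fun h => hy'.symm.trans h⟩
    show k ≤ (openCluster ω y).ncard ∧
      ¬ ∃ i : Fin 3, ∀ t : ZMod n, ∃ y' ∈ openCluster ω y, y' i = t
    rw [hC]
    exact ⟨hk₀, hns⟩

end Summit.CriticalPhenomena.PercolationContinuityZ3.Theorems.PercTorusSliceFillingNoCriticalTorusGiant
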